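import Summits.BirchSwinnertonDyer.BirchSwinnertonDyer.Theorems.GenusKolyvaginAtTwoGenusPrimitiveSupplyAtTwoCasselsTateRadicalKernel
import Summits.BirchSwinnertonDyer.BirchSwinnertonDyer.Theorems.GenusKolyvaginAtTwoGenusPrimitiveSupplyAtTwoPrimeTwistRigidity
import Summits.BirchSwinnertonDyer.BirchSwinnertonDyer.Theorems.GenusKolyvaginAtTwoGenusPrimitiveSupplyAtTwoArchimedeanEgg
import Summits.BirchSwinnertonDyer.BirchSwinnertonDyer.Theorems.GenusKolyvaginAtTwoGenusPrimitiveSupplyAtTwoQuadraticCharacterExists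
import Summits.BirchSwinnertonDyer.Rank1Residual.GaloisImage.KummerClassLocalDivisibility
import Literature.NumberTheory.EllipticCurves.TwoAdicImageQuadraticTwistProofs
import Literature.NumberTheory.EllipticCurves.PrimeConductorTwoTorsionNormalFormProofs
import Literature.NumberTheory.EllipticCurves.SelmerGroupCardinality
import HarnessLib

/-!
# Route `GenusKolyvaginAtTwo`, crux #2 `GenusPrimitiveSupplyAtTwo` (stmt-BirchSwinnertonDyer-22136):
# **B⁰ `F1Sign2.OddBranchEggBitEqRadicalBitAtTwo` BY NAME** — the egg bit of `W^{(d)}` is the radical-leaves-`S` bit of `A_χ`;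
# hence THEOREM B `F1Sign2.OddBranchEggCasselsTateParityLawOfPosRankAtTwo` from DESC-A alone

Width seat `bsd-line-gk2-p5` g16 (cell `bsd-f1-sign2`, SUPPLY lineage of crux 22136), file 43 of the series; sequel of file 42
`…CasselsTateRadicalKernel` (the KERNEL LEMMA `Ш[2] ∩ 2Ш[4] = 0` for an odd form with `#Ш[2] ≤ 4`), files 39–41 (the MODEL ↔
`PrimeTwist` dictionary `(ψ, Φ)`, U′, the odd-branch `R = Sel₂^{rel ∞}(W)` / `S = {loc_∞ = 0}`), file 30 (the real egg) and the
`GaloisImage` transport `res_L (ψ_* c) = 0 ↔ res_L c = 0`. THEOREMS ONLY (no definition, no named fact, no `sorry`); helper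
`--supports stmt-BirchSwinnertonDyer-22136`; no item is closed; BSD is not proved by any of this.

WHAT.
* §188 `eggBit_iff_twistRadicalLeaves_of_model` — for `W` on the odd branch, `d` descent-admissible with character `χ`, and ANY
  model `V = C • W^{(d)}` whose rank is positive when its Cassels–Tate form is odd:
  `(θ(V) = − ∧ MeetsEgg V) ↔ TwistRadicalLeavesAtTwo W χ Sel₂(W)`.  Proof.  (θ) is file 40's
  `shaTwoInTwiceShaFour_iff_not_twistCasselsTateOddAtTwo`.  (⇒) the Kummer class `κ(P)` of an egg point lies in the radical
  (its image in `Ш(A_χ)` is `0 = 2·0`, by the square `Φ_* ∘ (H¹(ℚ,V[2]) → H¹(ℚ,V)) = twistShaMap ∘ ψ_*` and exactness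
  `torsionH1ToH1_kummerMapTorsion`) and outside `S = {r ∈ R : loc_∞ r = 0}` (file 41), because `loc_∞ ψ_* κ(P) = 0` iff `P`
  halves in `V(ℚ_∞)` (`GaloisImage.VisibleIndependence.res_h1Equiv_eq_zero_iff` + file 30's `localization_kummerMapTorsion_eq_zero_iff`), impossible on the egg
  (`not_onEgg_of_add_self_eq_baseChange`).  (⇐) a radical class `x ∉ S` pulls back to `y = ψ_*⁻¹ x ∈ Sel₂(V)` whose image
  `t ∈ Ш(V)[2]` is `2c''`, `c'' = Φ_*⁻¹ c' ∈ Ш(V)[4]`; `#Sel₂(V) = 8` (dictionary count) and rank `≥ 1` give `#Ш(V)[2] ≤ 4`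
  (`card_selmerGroup_eq_pow_rank_mul`), so the KERNEL LEMMA (file 42) forces `t = 0`; then `y = κ(P)` (exactness
  `mem_range_kummerMapTorsion_of_torsionH1ToH1_eq_zero`), and if `V(ℚ)` missed the egg `P` would halve in `V(ℚ_∞)`
  (`exists_add_self_eq_baseChange_of_not_onEgg`), i.e. `loc_∞ x = 0`, i.e. `x ∈ S` — contradiction.
* §190 `natCard_sha_two_eq_four_and_exponent_two_of_natCard_le_four` — THE FULL KERNEL LEMMA (every number field, unconditional):
  `#Ш(V/K)[2] ≤ 4` (finite) and `θ(V) = −` force `#Ш[2] = 4` EXACTLY (order `≤ 3` would put `Ш[2] ⊆ {0, s}`, impossible for an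
  alternating divisible-kernel form: file 42 §186 with `c = 0`) and `Ш[2^∞] = Ш[2]` (file 42 §187 iterated).
* §191 `mordellWeilRank_eq_one_of_not_shaTwoInTwiceShaFour_of_model` — MEMO-desc §16 (K) on the frame: `W` on the odd branch, `d`
  descent-admissible, `V = C • W^{(d)}` with `θ(V) = −` and rank `≥ 1` ⟹ `rank V(ℚ) = 1`, `#Ш(V)[2] = 4`, `Ш(V)[2^∞] = Ш(V)[2]`.
* §189 **`oddBranchEggBitEqRadicalBitAtTwo_holds : F1Sign2.OddBranchEggBitEqRadicalBitAtTwo`** (the row B⁰ BY NAME, `C = 1`) and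
  **`oddBranchEggCasselsTateParityLawOfPosRankAtTwo_of_sumLaw : OddBranchCasselsTateRadicalSumLawAtTwo →
  OddBranchEggCasselsTateParityLawOfPosRankAtTwo`** — THEOREM B (REF1 §35's repair DESC-P′ of DESC-P) now follows from DESC-A
  (Morgan 2023 Prop. 19 / Morgan–Smith trilinearity, NOT proved here) ALONE: the typer's glue `eggParityLawOfPosRank_of_radicalLaw` fed
  with A∞ ⟸ DESC-A (file 40), B⁰ (here) and `GenusKolyTransp.quadraticCharacterExists_holds`.

Honest framing: the kernel lemma and the real-component lemma are classical (Cassels 1962 §1; Kramer 1981 Prop. 6; MS21 Thm 1.3);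
the bridge B⁰ is the cell's own bookkeeping between the two formalisms (REF1-AUDIT §41: theorem-grade modulo the dictionary, which
is file 40); kernel-new; beyond-print theorem: no. Crux 22136 stays OPEN exactly at (U) 24947 ∧ (CONV₂) 19220/24948. BSD is not
proved by any of this.

References: [Cassels1962ArithmeticIV] §1; [Kramer1981] Prop. 6, Thm. 1; [MorganSmith2021CTP] Thm. 1.3; [MazurRubin2007] §3,
Prop. 4.1, Def. 4.3; [MazurRubin2010] Lemma 3.2, Prop. 3.3; [SilvermanAEC2009] VIII.§2, X.§4, Thm. X.4.2(a); [Morgan2023KummerGeneric]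
§1.2, Prop. 19.
-/

set_option linter.dupNamespace false -- tree convention: `Summit.BirchSwinnertonDyer.BirchSwinnertonDyer.Theorems` (summit = sub-problem)
set_option autoImplicit false

noncomputable section

open scoped Classical

namespace Summit.BirchSwinnertonDyer.BirchSwinnertonDyer.Theorems.GenusKolyArch

open WeierstrassCurve Field NumberField IsDedekindDomain
open Literature.NumberTheory.EllipticCurves Literature.NumberTheory.GaloisRepresentations
open Literature.NumberTheory.GaloisCohomology
open Summit.BirchSwinnertonDyer.Rank1Residual.X11b.KummerPT (kummerStrict)
open Summit.BirchSwinnertonDyer.Rank1Residual.F1Sign2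
open Summit.BirchSwinnertonDyer.Rank1Residual.F1Sign2.EggDoubling (psiTwo psiTwo_ne_zero)
open Literature.NumberTheory.EllipticCurves.Greenberg1999 (HasRationalTwoTorsionX)

universe u

/-! ## §188 The egg bit is the radical bit, for any model of the admissible twist -/

section Model

variable (W : WeierstrassCurve ℚ) [W.IsElliptic] [W.IsGloballyMinimal] {d : ℤ}
  {χ : absoluteGaloisGroup ℚ →ₜ* Multiplicative (ZMod 2)}

omit [W.IsElliptic] [W.IsGloballyMinimal] in
/-- **The `H¹` square of the dictionary** (file 39/40's pair `(ψ, Φ)` for a model `V` of `E^{(d)}`):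
`Φ_* ∘ (H¹(ℚ, V[2]) → H¹(ℚ, V)) = twistShaMapAtTwo ∘ ψ_*` — functoriality plus `Φ|_{V[2]} = constEmb ∘ ψ` (file 40 §181, isolated).
[cite: MazurRubin2007, §3, Prop 4.1 and Def 4.3] -/
theorem h1Equiv_torsionH1ToH1_eq_twistShaMapAtTwo {V : WeierstrassCurve ℚ}
    (ψ : geomTorsion V ((2 : ℕ) : ℤ) ≃+ geomTorsion W ((2 : ℕ) : ℤ))
    (hψ : ∀ (g : absoluteGaloisGroup ℚ) (t : geomTorsion V ((2 : ℕ) : ℤ)), ψ (g • t) = g • ψ t)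
    (Φ : geomPoints V ≃+ PrimeTwist.geomModule W χ)
    (hΦ : ∀ (g : absoluteGaloisGroup ℚ) (P : geomPoints V), Φ (g • P) = g • Φ P)
    (htors : ∀ t : geomTorsion V ((2 : ℕ) : ℤ), Φ (t : geomPoints V) =
      PrimeTwist.constEmb (χ : absoluteGaloisGroup ℚ →* Multiplicative (ZMod 2)) W.geomPoints (ψ t))
    (x : V.galH1Torsion ((2 : ℕ) : ℤ)) :
    h1Equiv Φ hΦ (V.torsionH1ToH1 ((2 : ℕ) : ℤ) x) = twistShaMapAtTwo W χ (h1Equiv ψ hψ x) := by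
  change resH1Hom (ContinuousMonoidHom.id _) (Φ : geomPoints V →+ PrimeTwist.geomModule W χ) hΦ
      (resH1Hom (ContinuousMonoidHom.id _) (geomTorsion V ((2 : ℕ) : ℤ)).subtype (fun _ _ ↦ rfl) x) =
    resH1Hom (ContinuousMonoidHom.id _)
      (PrimeTwist.constEmb (χ : absoluteGaloisGroup ℚ →* Multiplicative (ZMod 2)) W.geomPoints) (fun _ _ ↦ rfl)
      (resH1Hom (ContinuousMonoidHom.id _) (ψ : geomTorsion V ((2 : ℕ) : ℤ) →+ geomTorsion W ((2 : ℕ) : ℤ)) hψ x)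
  rw [resH1Hom_resH1Hom, resH1Hom_resH1Hom]
  exact DFunLike.congr_fun (resH1Hom_congr rfl (AddMonoidHom.ext fun t ↦ htors t) _ _) x

/-- **§188 — THE EGG BIT IS THE RADICAL BIT, for ANY model `V = C • W^{(d)}`** (`W` on the odd branch, `d` descent-admissible with
character `χ`, and `rank V(ℚ) ≥ 1` whenever `θ(V) = −`): `θ(V) = −` and `V(ℚ)` meets the egg iff the Cassels–Tate form of `A_χ` is
odd and its radical is not inside `S = Sel₂(W)`. See the module docstring for the proof. [cite: Kramer1981, Prop. 6] [cite: Cassels1962ArithmeticIV, §1]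
[cite: MorganSmith2021CTP, Thm 1.3] [cite: MazurRubin2007, §3, Prop 4.1 and Def 4.3] [cite: MazurRubin2010, Lemma 3.2] -/
theorem eggBit_iff_twistRadicalLeaves_of_model (hodd : OnOddBranchAtTwo W) (hd : DescAdmissible W d)
    (hχ : IsQuadraticCharacterOf χ d) {V : WeierstrassCurve ℚ} [V.IsElliptic] {C : VariableChange ℚ}
    (hWd : C • W.quadraticTwist (d : ℚ) = V) (hrk : ¬ ShaTwoInTwiceShaFour V → 0 < V.mordellWeilRank) :
    (¬ ShaTwoInTwiceShaFour V ∧ MeetsEgg V) ↔ TwistRadicalLeavesAtTwo W χ (W.selmerGroup ((2 : ℕ) : ℤ)) := by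
  have hΔ : 0 < W.Δ := hodd.1
  have hT : NoRationalTwoTorsion W := hodd.2.1
  have hd0 : d ≠ 0 := hd.1.ne
  have hd0' : ((d : ℤ) : ℚ) ≠ 0 := Int.cast_ne_zero.mpr hd0
  have h2 : ((2 : ℕ) : ℤ) ≠ 0 := by norm_num
  set w : InfinitePlace ℚ := Rat.infinitePlace with hw
  -- (a) the model: `Δ_V > 0`, no rational `2`-torsion, `#Sel₂(V) = 8`
  have hΔV : 0 < V.Δ := by
    rw [← hWd, variableChange_Δ, quadraticTwist_Δ]
    exact mul_pos (Even.pow_pos (by decide) (C.u⁻¹).ne_zero) (mul_pos (Even.pow_pos (by decide) hd0') hΔ)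
  have hTV : NoRationalTwoTorsion V := by
    intro x hx
    have h' : HasRationalTwoTorsionX (W.quadraticTwist (d : ℚ)) (C⁻¹.toX x) := by
      have h := PrimeConductorTwoTorsion.hasRationalTwoTorsionX_smul V C⁻¹ hx
      rwa [← hWd, inv_smul_smul] at h
    obtain ⟨x', hx'⟩ := (exists_hasRationalTwoTorsionX_quadraticTwist_iff W hd0').mp ⟨_, h'⟩
    exact hT x' hx'
  have hSel8 : Nat.card (V.selmerGroup ((2 : ℕ) : ℤ)) = 8 := by
    rw [← natCard_primeTwist_selmerGroup_eq_natCard_selmerGroup_rat W hd0 hχ hWd,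
      natCard_primeTwist_selmerGroup_eq_twistSelmerTwoCard W hd0 hχ]
    exact hodd.2.2.2.2 d hd
  -- (b) the dictionary `(ψ, Φ)` and the θ-bit
  obtain ⟨ψ, hψ, Φ, hΦ, htors, hSel, hSha⟩ := exists_primeTwistModel_selmerGroup_sha_iff W hd0' hWd χ
    (smul_geomSqrt_iff_of_isQuadraticCharacterOf hχ)
  have hsq := h1Equiv_torsionH1ToH1_eq_twistShaMapAtTwo W ψ hψ Φ hΦ htors
  have hθ : ShaTwoInTwiceShaFour V ↔ ¬ TwistCasselsTateOddAtTwo W χ :=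
    shaTwoInTwiceShaFour_iff_not_twistCasselsTateOddAtTwo W hd0 hχ hWd
  -- (c) `S = {r ∈ R : loc_∞ r = 0}` inside `R = Sel_𝔓(A_χ) = Sel₂^{rel ∞}(W)`
  have hR : PrimeTwist.selmerGroup W χ = selmerGroupRelaxedAtInfinityAtTwo W :=
    primeTwist_selmerGroup_eq_relaxed_of_onOddBranch W hodd hd hχ
  have hSiff : ∀ x ∈ PrimeTwist.selmerGroup W χ, x ∈ W.selmerGroup ((2 : ℕ) : ℤ) ↔
      galoisCohomology.localization (W.torsionGaloisModule ((2 : ℕ) : ℤ)) (Sum.inl w) 1 x = 0 := by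
    intro x hx
    have hxR' : x ∈ selmerGroupRelaxedAtInfinityAtTwo W := hR ▸ hx
    refine (SetLike.ext_iff.mp (selmerGroup_eq_kummerStrict_of_onOddBranch W hodd hd hχ w) x).trans ?_
    refine (mem_selmerGroup_kummerStrict_singleton_inl_iff W w x).trans ?_
    exact ⟨fun h ↦ h.2, fun h ↦ ⟨hxR', h⟩⟩
  -- (d) `loc_∞ ψ_* κ(P) = 0 ↔ loc_∞ κ(P) = 0 ↔ P halves in V(ℚ_∞)` (NB: no `CharZero (ℚ_∞)` local instance here — it would let
  -- `DivisionRing.toRatAlgebra` shadow the completion's `ℚ`-algebra structure used inside `localization`)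
  have hκ : ∀ P : V.toAffine.Point,
      galoisCohomology.localization (W.torsionGaloisModule ((2 : ℕ) : ℤ)) (Sum.inl w) 1
          (h1Equiv ψ hψ (kummerMapTorsion V _ (hdiv_two V) P)) = 0 ↔
        ∃ R : (V.baseChange (Place.Completion (Sum.inl w : Place ℚ))).toAffine.Point,
          ((2 : ℕ) : ℤ) • R = Affine.Point.baseChange (W' := V) ℚ (Place.Completion (Sum.inl w : Place ℚ)) P :=
    fun P ↦ (Summit.BirchSwinnertonDyer.Rank1Residual.GaloisImage.VisibleIndependence.res_h1Equiv_eq_zero_iff W V ψ hψ _ _).trans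
      (localization_kummerMapTorsion_eq_zero_iff V h2 (hdiv_two V) (Sum.inl w) P)
  have e : Place.Completion (Sum.inl w : Place ℚ) ≃+* ℝ :=
    InfinitePlace.Completion.ringEquivRealOfIsReal Rat.isReal_infinitePlace
  constructor
  · rintro ⟨hθneg, px, py, hpxy, hon⟩
    refine ⟨by by_contra h; exact hθneg (hθ.mpr h), ?_⟩
    have hns : V.toAffine.Nonsingular px py := (Affine.equation_iff_nonsingular (W := V)).mp hpxy
    have hκSel : kummerMapTorsion V _ (hdiv_two V) (.some px py hns) ∈ V.selmerGroup ((2 : ℕ) : ℤ) :=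
      kummerMapTorsion_mem_selmerGroup V _ (hdiv_two V) _
    refine ⟨h1Equiv ψ hψ (kummerMapTorsion V _ (hdiv_two V) (.some px py hns)),
      ⟨(hSel _).mp hκSel, _, (PrimeTwist.sha W χ).zero_mem, nsmul_zero _, ?_⟩, fun hxS ↦ ?_⟩
    · rw [nsmul_zero, ← hsq, torsionH1ToH1_kummerMapTorsion, map_zero]
    · obtain ⟨R, hR2⟩ := (hκ _).mp ((hSiff _ ((hSel _).mp hκSel)).mp hxS)
      rw [Nat.cast_ofNat, two_zsmul] at hR2
      change R + R = .some (algebraMap ℚ _ px) (algebraMap ℚ _ py) _ at hR2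
      exact not_onEgg_of_add_self_eq_baseChange V e.toRingHom R hR2 hon
  · rintro ⟨hct, x, ⟨hxR, c', hc'sha, hc'4, hc'2⟩, hxS⟩
    have hθneg : ¬ ShaTwoInTwiceShaFour V := fun h ↦ hθ.mp h hct
    refine ⟨hθneg, ?_⟩
    by_contra hegg
    have hrank : 0 < V.mordellWeilRank := hrk hθneg
    -- `y := ψ_*⁻¹ x ∈ Sel₂(V)`, its image `t ∈ Ш(V)[2]`, and `c'' := Φ_*⁻¹ c' ∈ Ш(V)[4]` with `2c'' = t`
    set y : V.galH1Torsion ((2 : ℕ) : ℤ) := (h1Equiv ψ hψ).symm x with hy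
    have hxy : h1Equiv ψ hψ y = x := (h1Equiv ψ hψ).apply_symm_apply x
    have hySel : y ∈ V.selmerGroup ((2 : ℕ) : ℤ) := (hSel y).mpr (hxy.symm ▸ hxR)
    set c'' : V.galH1 := (h1Equiv Φ hΦ).symm c' with hc''
    have hcc : h1Equiv Φ hΦ c'' = c' := (h1Equiv Φ hΦ).apply_symm_apply c'
    have hc''sha : c'' ∈ V.sha := (hSha _).mpr (hcc.symm ▸ hc'sha)
    have hc''4 : (4 : ℕ) • c'' = 0 := (h1Equiv Φ hΦ).injective (by rw [map_nsmul, hcc, hc'4, map_zero])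
    have hc''2 : (2 : ℕ) • c'' = V.torsionH1ToH1 ((2 : ℕ) : ℤ) y :=
      (h1Equiv Φ hΦ).injective (by rw [map_nsmul, hcc, hc'2, hsq, hxy])
    -- `#Ш(V)[2] ≤ 4` and `≠ 0`: the descent count `8 = 2^rank · #V(ℚ)[2] · #Ш(V)[2]` with rank `≥ 1`
    have hcount := card_selmerGroup_eq_pow_rank_mul V 2
    rw [hSel8] at hcount
    have key : ∀ r a b : ℕ, 8 = 2 ^ r * a * b → 0 < r → b ≤ 4 ∧ b ≠ 0 := by
      intro r a b h hr
      have hb0 : b ≠ 0 := by rintro rfl; simp at h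
      have ha0 : a ≠ 0 := by rintro rfl; simp at h
      have h2r : 2 ≤ 2 ^ r := by
        calc (2 : ℕ) = 2 ^ 1 := (pow_one 2).symm
          _ ≤ 2 ^ r := Nat.pow_le_pow_right two_pos hr
      have hle : 2 * b ≤ 2 ^ r * a * b := by
        calc 2 * b = 2 * 1 * b := by rw [mul_one]
          _ ≤ 2 ^ r * a * b := Nat.mul_le_mul_right b (Nat.mul_le_mul h2r (Nat.one_le_iff_ne_zero.mpr ha0))
      exact ⟨by omega, hb0⟩
    obtain ⟨hcard, hcard0⟩ := key _ _ _ hcount hrank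
    -- THE KERNEL LEMMA: `t = 2c'' = 0`
    have ht0 : (2 : ℕ) • c'' = 0 :=
      sha_two_nsmul_eq_zero_of_four_nsmul_of_natCard_le_four V hcard hcard0 hθneg hc''sha hc''4
    have hty : V.torsionH1ToH1 ((2 : ℕ) : ℤ) y = 0 := hc''2.symm.trans ht0
    -- so `y = κ(P)` for a rational point `P`, off the egg, which halves in `V(ℚ_∞)`: `loc_∞ x = 0`, `x ∈ S`
    obtain ⟨P, hP⟩ := mem_range_kummerMapTorsion_of_torsionH1ToH1_eq_zero V _ (hdiv_two V) y hty
    have hloc0 : galoisCohomology.localization (W.torsionGaloisModule ((2 : ℕ) : ℤ)) (Sum.inl w) 1 x = 0 := by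
      rw [← hxy, ← hP]
      refine (hκ P).mpr ?_
      rcases P with _ | ⟨px, py, hpxy⟩
      · exact ⟨0, by rw [zsmul_zero]; rfl⟩
      · have hx0 : psiTwo V px ≠ 0 := psiTwo_ne_zero V hTV px
        have hoff : ¬ OnEgg V px := fun h ↦ hegg ⟨px, py, hpxy.1, h⟩
        obtain ⟨h', hP'⟩ : ∃ h', Affine.Point.baseChange (W' := V) ℚ (Place.Completion (Sum.inl w : Place ℚ))
            (.some px py hpxy) = .some (algebraMap ℚ _ px) (algebraMap ℚ _ py) h' := ⟨_, rfl⟩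
        obtain ⟨Q, hQ⟩ := exists_add_self_eq_baseChange_of_not_onEgg V e hΔV hx0 hoff h'
        refine ⟨Q, ?_⟩
        rw [Nat.cast_ofNat, two_zsmul, hQ]
        exact hP'.symm
    exact hxS ((hSiff x hxR).mpr hloc0)

end Model

/-! ## §190 The full kernel lemma: `θ = −` with `#Ш[2] ≤ 4` forces `#Ш[2] = 4` and `Ш[2^∞] = Ш[2]`; on the frame, rank `1` -/

section KernelFull

/-- **Counting in a subgroup of order `≤ 3`.** If a finite subgroup `H` with `#H ≤ 3` contains `s ≠ 0` with `2 • s = 0`, then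
`H ⊆ {0, s}` (a third element `x` would bring a fourth, `s + x`). [folklore] -/
theorem mem_zero_or_eq_of_natCard_le_three {G : Type*} [AddCommGroup G] (H : AddSubgroup G) [Finite H]
    (hH : Nat.card H ≤ 3) {s : G} (hs : s ∈ H) (hs0 : s ≠ 0) (h2s : 2 • s = 0) (x : G) (hx : x ∈ H) :
    x = 0 ∨ x = s := by
  by_contra hne
  push Not at hne
  obtain ⟨hx0, hxs⟩ := hne
  have hnegs : -s = s := by rw [neg_eq_iff_add_eq_zero, ← two_nsmul, h2s]
  have hsx0 : s + x ≠ 0 := fun h ↦ hxs (by rw [add_comm, add_eq_zero_iff_eq_neg, hnegs] at h; exact h)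
  have hsxs : s + x ≠ s := fun h ↦ hx0 (by simpa using h)
  have hsxx : s + x ≠ x := fun h ↦ hs0 (by simpa using h)
  have hfin : (H : Set G).Finite := Set.toFinite _
  have h4 : ({0, s, x, s + x} : Set G).ncard = 4 := by
    rw [Set.ncard_insert_of_notMem, Set.ncard_insert_of_notMem, Set.ncard_pair hsxx.symm]
    · simp only [Set.mem_insert_iff, Set.mem_singleton_iff, not_or]
      exact ⟨hxs.symm, hsxs.symm⟩
    · simp only [Set.mem_insert_iff, Set.mem_singleton_iff, not_or]
      exact ⟨hs0.symm, hx0.symm, hsx0.symm⟩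
  have hsub : ({0, s, x, s + x} : Set G) ⊆ (H : Set G) := by
    intro y hy
    simp only [Set.mem_insert_iff, Set.mem_singleton_iff] at hy
    rcases hy with rfl | rfl | rfl | rfl
    · exact H.zero_mem
    · exact hs
    · exact hx
    · exact H.add_mem hs hx
  have hle := Set.ncard_le_ncard hsub hfin
  have hcard : (H : Set G).ncard = Nat.card H := (Nat.card_coe_set_eq (H : Set G)).symm
  rw [h4, hcard] at hle
  omega

/-- **§190 — THE FULL KERNEL LEMMA** (every number field `K : Type`, every elliptic `V/K`, unconditional). If `Ш(V/K)[2]` is finite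
of order `≤ 4` and the Cassels–Tate form is odd (`θ(V) = −`: some class of `Ш[2]` is not twice a class of `Ш[4]`), then
`#Ш(V/K)[2] = 4` EXACTLY and `Ш(V/K)[2^∞] = Ш(V/K)[2]` (no class of order `4`, hence none of order `2^k`, `k ≥ 2`). Order `≤ 3`
would put `Ш[2] ⊆ {0, s}`, impossible for an alternating divisible-kernel form (§186 with `c = 0`); the exponent statement is
§187 iterated. (For `Ш` finite this is «`Ш[2^∞] ≅ L × L` with `L = ℤ/2`», Cassels 1962; no finiteness is used here.)
[cite: Cassels1962ArithmeticIV, §1 and Thm 1.2] [cite: SilvermanAEC2009, Thm. X.4.14] -/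
theorem natCard_sha_two_eq_four_and_exponent_two_of_natCard_le_four {K : Type} [Field K] [NumberField K]
    (V : WeierstrassCurve K) [V.IsElliptic]
    (hcard : Nat.card ↥(V.sha ⊓ AddSubgroup.torsionBy V.galH1 ((2 : ℕ) : ℤ)) ≤ 4)
    (hcard0 : Nat.card ↥(V.sha ⊓ AddSubgroup.torsionBy V.galH1 ((2 : ℕ) : ℤ)) ≠ 0)
    (hodd : ¬ ∀ s ∈ V.sha, (2 : ℕ) • s = 0 → ∃ c' ∈ V.sha, (4 : ℕ) • c' = 0 ∧ (2 : ℕ) • c' = s) :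
    Nat.card ↥(V.sha ⊓ AddSubgroup.torsionBy V.galH1 ((2 : ℕ) : ℤ)) = 4 ∧
      ∀ c ∈ V.sha, ∀ k : ℕ, (2 ^ k : ℕ) • c = 0 → (2 : ℕ) • c = 0 := by
  haveI : Finite ↥(V.sha ⊓ AddSubgroup.torsionBy V.galH1 ((2 : ℕ) : ℤ)) := Nat.finite_of_card_ne_zero hcard0
  set H : AddSubgroup V.galH1 := V.sha ⊓ AddSubgroup.torsionBy V.galH1 ((2 : ℕ) : ℤ) with hH
  have hmemH : ∀ x : V.galH1, x ∈ H ↔ x ∈ V.sha ∧ (2 : ℕ) • x = 0 := fun x ↦ by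
    rw [hH, AddSubgroup.mem_inf, AddSubgroup.torsionBy.nsmul_iff]
  refine ⟨?_, ?_⟩
  · -- `#Ш[2] ≤ 3` is impossible
    by_contra hne
    have hle3 : Nat.card H ≤ 3 := by omega
    have hodd' := hodd
    push Not at hodd'
    obtain ⟨s, hs, hs2, hsnot⟩ := hodd'
    obtain ⟨B, halt, hker⟩ := exists_casselsTate_pairing_holds (K := K) V
    have hs0 : s ≠ 0 := fun h ↦ hsnot 0 V.sha.zero_mem (nsmul_zero _) (by rw [nsmul_zero, h])
    have hsH : s ∈ H := (hmemH s).mpr ⟨hs, hs2⟩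
    have henum := mem_zero_or_eq_of_natCard_le_three H hle3 hsH hs0 hs2
    refine false_of_alternating_of_twoTorsion_subset_four (T := ↥V.sha) V.isTorsion_sha B halt
      (fun x hx n hn ↦ (AddSubgroup.mem_divisibleElements_iff _ x).mp ((hker x).mp hx) n hn)
      (s := ⟨s, hs⟩) (c := 0) (Subtype.ext hs2) (nsmul_zero _) (fun c' h4' h2' ↦ ?_) (fun x hx ↦ ?_)
    · exact hsnot c' c'.2 (congrArg Subtype.val h4') (congrArg Subtype.val h2')
    · have hx' : (x : V.galH1) ∈ H := (hmemH _).mpr ⟨x.2, congrArg Subtype.val hx⟩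
      rcases henum x hx' with h | h
      · exact Or.inl (Subtype.ext h)
      · exact Or.inr (Or.inl (Subtype.ext h))
  · -- `Ш[2^∞] = Ш[2]`: §187 iterated
    intro c hc k
    induction k using Nat.strong_induction_on generalizing c with
    | _ k ih =>
      intro hk
      rcases k with _ | k
      · rw [pow_zero, one_nsmul] at hk
        rw [hk, nsmul_zero]
      rcases k with _ | k
      · simpa using hk
      -- `k + 2`: `c₁ = 2^k • c` has `4 • c₁ = 0`, so `2 • c₁ = 0` (§187), i.e. `2^(k+1) • c = 0`
      have hc₁ : (2 : ℕ) • ((2 ^ k : ℕ) • c) = 0 := by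
        refine sha_two_nsmul_eq_zero_of_four_nsmul_of_natCard_le_four V hcard hcard0 hodd (V.sha.nsmul_mem hc _) ?_
        rw [← mul_nsmul', show 4 * 2 ^ k = 2 ^ (k + 2) by ring, hk]
      refine ih (k + 1) (by omega) c hc ?_
      rw [pow_succ, mul_comm, mul_nsmul', hc₁]

end KernelFull

section Frame

variable (W : WeierstrassCurve ℚ) [W.IsElliptic] [W.IsGloballyMinimal] {d : ℤ}
  {χ : absoluteGaloisGroup ℚ →ₜ* Multiplicative (ZMod 2)}

omit [W.IsElliptic] in
/-- **§191 — MEMO-desc §16's KERNEL LEMMA (K) on the odd-branch frame, for ANY model `V = C • W^{(d)}`** (`W` on the odd branch, `d`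
descent-admissible with character `χ`): if `θ(V) = −` and `rank V(ℚ) ≥ 1` then `rank V(ℚ) = 1` EXACTLY, `#Ш(V)[2] = 4` and
`Ш(V)[2^∞] = Ш(V)[2]` (so `Ш(V)[2^∞] ≅ (ℤ/2)²` and the Cassels–Tate radical on `Sel₂(V) ≅ 𝔽₂³` is the Mordell–Weil LINE).  The
descent count `8 = #Sel₂(V) = 2^{rank}·#V(ℚ)[2]·#Ш(V)[2]` (dictionary count + `card_selmerGroup_eq_pow_rank_mul`) feeds §190.
[cite: Cassels1962ArithmeticIV, §1] [cite: Kramer1981, Prop. 6] [cite: SilvermanAEC2009, Thm X.4.2(a)] -/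
theorem mordellWeilRank_eq_one_of_not_shaTwoInTwiceShaFour_of_model (hodd : OnOddBranchAtTwo W) (hd : DescAdmissible W d)
    (hχ : IsQuadraticCharacterOf χ d) {V : WeierstrassCurve ℚ} [V.IsElliptic] {C : VariableChange ℚ}
    (hWd : C • W.quadraticTwist (d : ℚ) = V) (hθ : ¬ ShaTwoInTwiceShaFour V) (hrk : 0 < V.mordellWeilRank) :
    V.mordellWeilRank = 1 ∧ Nat.card ↥(V.sha ⊓ AddSubgroup.torsionBy V.galH1 ((2 : ℕ) : ℤ)) = 4 ∧
      ∀ c ∈ V.sha, ∀ k : ℕ, (2 ^ k : ℕ) • c = 0 → (2 : ℕ) • c = 0 := by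
  have hd0 : d ≠ 0 := hd.1.ne
  have hSel8 : Nat.card (V.selmerGroup ((2 : ℕ) : ℤ)) = 8 := by
    rw [← natCard_primeTwist_selmerGroup_eq_natCard_selmerGroup_rat W hd0 hχ hWd,
      natCard_primeTwist_selmerGroup_eq_twistSelmerTwoCard W hd0 hχ]
    exact hodd.2.2.2.2 d hd
  have hcount := card_selmerGroup_eq_pow_rank_mul V 2
  rw [hSel8] at hcount
  have key : ∀ r a b : ℕ, 8 = 2 ^ r * a * b → 0 < r → b ≤ 4 ∧ b ≠ 0 ∧ (b = 4 → r = 1) := by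
    intro r a b h hr
    have hb0 : b ≠ 0 := by rintro rfl; simp at h
    have ha0 : a ≠ 0 := by rintro rfl; simp at h
    have h2r : 2 ≤ 2 ^ r := by
      calc (2 : ℕ) = 2 ^ 1 := (pow_one 2).symm
        _ ≤ 2 ^ r := Nat.pow_le_pow_right two_pos hr
    have hle : 2 * b ≤ 2 ^ r * a * b := by
      calc 2 * b = 2 * 1 * b := by rw [mul_one]
        _ ≤ 2 ^ r * a * b := Nat.mul_le_mul_right b (Nat.mul_le_mul h2r (Nat.one_le_iff_ne_zero.mpr ha0))
    refine ⟨by omega, hb0, fun hb ↦ ?_⟩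
    subst hb
    have h2 : 2 ^ r * a = 2 := by omega
    have hr2 : 2 ^ r ≤ 2 := by
      calc 2 ^ r = 2 ^ r * 1 := (mul_one _).symm
        _ ≤ 2 ^ r * a := Nat.mul_le_mul_left _ (Nat.one_le_iff_ne_zero.mpr ha0)
        _ = 2 := h2
    have hr1 : r < 2 := by
      by_contra hge
      push Not at hge
      have h4 : 4 ≤ 2 ^ r := by
        calc (4 : ℕ) = 2 ^ 2 := rfl
          _ ≤ 2 ^ r := Nat.pow_le_pow_right two_pos hge
      omega
    omega
  obtain ⟨hcard, hcard0, hr⟩ := key _ _ _ hcount hrk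
  obtain ⟨h4, hexp⟩ := natCard_sha_two_eq_four_and_exponent_two_of_natCard_le_four V hcard hcard0 hθ
  exact ⟨hr h4, h4, hexp⟩

end Frame

/-! ## §189 B⁰ BY NAME, and THEOREM B from DESC-A alone -/

/-- **B⁰ (DESC-§17-B⁰) `F1Sign2.OddBranchEggBitEqRadicalBitAtTwo` HOLDS.** On the odd branch, for every descent-admissible `d` with
character `χ` such that `W^{(d)}` has positive rank when its Cassels–Tate form is odd: the egg–Cassels–Tate bit of the model `W^{(d)}`
equals the bit «`θ(A_χ) = −` and the radical of the form leaves `S = Sel₂(W)`». §188 at `C = 1`. Known ingredients in print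
(Cassels 1962; Kramer 1981 Prop. 6; Mazur–Rubin 2007 §3); the bridge is the cell's bookkeeping; kernel-new; BSD is not proved by this.
[cite: Kramer1981, Prop. 6] [cite: Cassels1962ArithmeticIV, §1] [cite: MazurRubin2007, §3, Prop 4.1 and Def 4.3] -/
theorem oddBranchEggBitEqRadicalBitAtTwo_holds : OddBranchEggBitEqRadicalBitAtTwo := by
  intro W _ _ hodd d χ hd hχ hrk
  haveI : (W.quadraticTwist (d : ℚ)).IsElliptic := W.isElliptic_quadraticTwist (Int.cast_ne_zero.mpr hd.1.ne)
  exact eggBit_iff_twistRadicalLeaves_of_model W hodd hd hχ (one_smul _ _) hrk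

/-- **THEOREM B `F1Sign2.OddBranchEggCasselsTateParityLawOfPosRankAtTwo` from DESC-A ALONE.** The typer's glue
`eggParityLawOfPosRank_of_radicalLaw` fed with A∞ ⟸ DESC-A (file 40 `oddBranchCasselsTateRadicalRealParityLawAtTwo_of_sumLaw`), B⁰
(`oddBranchEggBitEqRadicalBitAtTwo_holds`) and `GenusKolyTransp.quadraticCharacterExists_holds`: on the odd branch, on every admissible
square quadruple whose odd-form members have positive rank, the number of egg–Cassels–Tate bits is EVEN — conditional ONLY on the sum law
`OddBranchCasselsTateRadicalSumLawAtTwo` (Morgan 2023 Prop. 19 / Morgan–Smith trilinearity; NOT proved here). BSD is not proved by this.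
[cite: Morgan2023KummerGeneric, §1.2, Prop 19] [cite: MorganSmith2021CTP, Thm 1.3, Prop 4.4] [cite: Kramer1981, Prop. 6] -/
theorem oddBranchEggCasselsTateParityLawOfPosRankAtTwo_of_sumLaw (hA : OddBranchCasselsTateRadicalSumLawAtTwo) :
    OddBranchEggCasselsTateParityLawOfPosRankAtTwo :=
  eggParityLawOfPosRank_of_radicalLaw (oddBranchCasselsTateRadicalRealParityLawAtTwo_of_sumLaw hA)
    oddBranchEggBitEqRadicalBitAtTwo_holds GenusKolyTransp.quadraticCharacterExists_holds

end Summit.BirchSwinnertonDyer.BirchSwinnertonDyer.Theorems.GenusKolyArch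

end
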